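import Summits.ResolutionOfSingularities.ResolutionOfSingularities.Theorems.PurelyInseparableDim4KangarooLoss
import Summits.ResolutionOfSingularities.ResolutionOfSingularities.Theorems.PurelyInseparableDim4NearDim
import HarnessLib
import HarnessLib.Audit.Tags

/-!
# Purely inseparable four-folds — RE-CHARTING A POINT STEP: the weights, the boundary and the loss count of the two
# presentations of one infinitely-near point (cell `res-dim4-pi`, K2(p) lane, slice C; kernel hand res-dim4-p-8 g5)

[OURS · counted 0 · cell `res-dim4-pi` · K2(p) lane (holder res-dim4-p-12 g4, 2026-08-29 06:49Z «PRESENTATION PRINCIPLE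
in kernel letters», serving the three re-presentation sockets hN4-C / hN4-C′ / hN4-D of
`…ResConeRepresentationSockets`); kernel hand res-dim4-p-8 g5.]  Nothing here proves K2(5), `NoIsolatedTrap 5 5` or
resolution of singularities in dimension ≥ 4 / characteristic `p` — NOT proved, not here, not anywhere in this programme.
AI kernel work, weaker than expert review.

WHAT.  A point step of the MODE-0 game (`CentreBlowup.step q univ j b s`: chart letter `j`, translation `b`, `b j = 0`)
presents the infinitely-near point with homogeneous coordinates `e_j + b` on the new exceptional hyperplane.  For every
letter `x ≠ j` with `b x ≠ 0` the SAME point is a point of the `x`-chart, with the RE-CHARTED translation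

  `b′ x = 0`, `b′ j = (b x)⁻¹`, `b′ i = b i / b x (i ∉ {j, x})`

(the scheme-level identity of the two chart immersions at this point is `ChartDictionary.chartImm_transpose`, part 17 of
brick S3 (c); here only the MODE-0 bookkeeping is read).  This file does the WEIGHT / BOUNDARY side of the re-presentation;
the `F`-side (order, isolation, `e_G`, residual cone through the diagonal transition) is res-dim4-p-1 g4's
`…ResConeRotationPartner` / `…ResConeLightLossyPartner` (`lossy_partner_package`, `lossy_step_twin`) and res-dim4-typ-1
g3's window transport.  Everything on the weight side depends on `b′` only through its ZERO PATTERN (`b′ x = 0`,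
`b′ j ≠ 0`, `b′ i = 0 ↔ b i = 0` off `{j, x}`), so each statement comes in a zero-pattern form (any such `b′`) and in the
explicit form (the `b′` above):

* §1 the re-charted translation: values and zero pattern (`rechart_zeroPattern`), involution (`rechart_rechart`: re-charting
  `b′` back at `j` returns `b`), cocycle (`rechart_rechart_of_ne`);
* §2 **`step_weights_of_rechart`** — `(step q univ x b′ s).r = (step q univ j b s).r ∘ swap j x` (as `Finsupp.mapDomain`;
  letter by letter `step_r_apply_rechart`), from `step_r_of_zeroPattern`; the boundary set `exc` likewise
  (`step_exc_of_rechart`); hence the same `|r′|` (`degree_step_r_of_zeroPattern`), the same «all weights `≤ m`» reading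
  (`step_r_le_iff_of_zeroPattern`), and the same shade AS SOON AS the two orders agree (`shade_step_of_zeroPattern` — the
  order identity is the `F`-side and is NOT proved here);
* §3 **the loss count is a datum of the POINT, not of the presentation**: the boundary letters non-zero at `e_j + b`,
  `B = {i : (i = j ∨ b i ≠ 0) ∧ s.r i ≠ 0}`, are the same set for `(x, b′)` (`boundaryLetters_of_zeroPattern`,
  **`lossCount_eq_of_rechart`**); the letters LOST by `(j, b)` are `B ∖ {j}` (`lostLetters_eq_erase`); `(j, b)` is
  loss-free iff `B ⊆ {j}` (`lossFree_iff_subset`); `(x, b′)` is loss-free iff `s.r j = 0 ∧ ∀ i ≠ x, b i ≠ 0 → s.r i = 0`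
  (`lossFree_rechart_iff`) — so a step losing ONE boundary letter `x` from a FREE chart letter is loss-free re-charted at
  `x` (**`lossFree_rechart_of_single_loss`**); some presentation of the point is loss-free iff `|B| ≤ 1`
  (`lossCount_le_one_iff_exists_lossFree`); and the step is GENUINELY LOSSY — lossy in every presentation of its point —
  iff `2 ≤ |B|` (**`two_le_lossCount_iff_forall_lossy`**).

Def-free.  [cite: HauserPerlega2019PRIMS, §2 (the blowup in the x₁-chart; transform D′ of D)]
[cite: Hauser2010, §F (transform D′)]
bears_on: LADDER-RESOLUTION:D157-DOOR2 (res-dim4-pi · K2(p) · slice C · re-charting weights).  Supports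
stmt-ResolutionOfSingularities-16155 (helper).
-/

set_option linter.dupNamespace false -- mandated namespace of this single-conjunct summit

noncomputable section

namespace Summit.ResolutionOfSingularities.ResolutionOfSingularities.Theorems.PIDim4

namespace ResCone

open MvPolynomial Finset
open Literature.AlgebraicGeometry.Resolution
open Literature.AlgebraicGeometry.Resolution.CentreBlowup
open Literature.AlgebraicGeometry.Resolution.Hauser2010

variable {K : Type} [Field K]

/-! ## §1 The re-charted translation -/

section Rechart

variable {j x : Fin 4} {b : Fin 4 → K}

/-- **Zero pattern of the re-charted translation** `b′ = (0 at x, (b x)⁻¹ at j, b i / b x else)` (`x ≠ j`, `b x ≠ 0`):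
`b′ x = 0`, `b′ j ≠ 0`, and off `{j, x}` it vanishes exactly where `b` does. [folklore] -/
theorem rechart_zeroPattern (hxj : x ≠ j) (hbx : b x ≠ 0) :
    (if x = x then (0 : K) else if x = j then (b x)⁻¹ else b x / b x) = 0 ∧
    (if j = x then (0 : K) else if j = j then (b x)⁻¹ else b j / b x) ≠ 0 ∧
    ∀ i, i ≠ j → i ≠ x →
      ((if i = x then (0 : K) else if i = j then (b x)⁻¹ else b i / b x) = 0 ↔ b i = 0) := by
  refine ⟨by simp, by simp [hxj.symm, hbx], fun i hij hix => ?_⟩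
  simp [hij, hix, hbx]

/-- **Involution**: re-charting `b′` back at the letter `j` (where `b′ j = (b x)⁻¹ ≠ 0`) returns `b` (`b j = 0`, `b x ≠ 0`).
[folklore] -/
theorem rechart_rechart (hxj : x ≠ j) (hbj : b j = 0) (hbx : b x ≠ 0) :
    (fun i => if i = j then (0 : K) else
      if i = x then (if j = x then (0 : K) else if j = j then (b x)⁻¹ else b j / b x)⁻¹ else
        (if i = x then (0 : K) else if i = j then (b x)⁻¹ else b i / b x) /
          (if j = x then (0 : K) else if j = j then (b x)⁻¹ else b j / b x)) = b := by
  funext i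
  by_cases hij : i = j
  · rw [if_pos hij, hij, hbj]
  · rw [if_neg hij]
    by_cases hix : i = x
    · rw [if_pos hix, hix]; simp [hxj.symm]
    · rw [if_neg hix]; simp [hij, hix, hxj.symm, hbx]

/-- **Cocycle**: re-charting `b′` at a third letter `y` (`b y ≠ 0`) is re-charting `b` at `y` directly. [folklore] -/
theorem rechart_rechart_of_ne {y : Fin 4} (hxj : x ≠ j) (hyj : y ≠ j) (hyx : y ≠ x) (hbx : b x ≠ 0) (hby : b y ≠ 0) :
    (fun i => if i = y then (0 : K) else
      if i = x then (if y = x then (0 : K) else if y = j then (b x)⁻¹ else b y / b x)⁻¹ else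
        (if i = x then (0 : K) else if i = j then (b x)⁻¹ else b i / b x) /
          (if y = x then (0 : K) else if y = j then (b x)⁻¹ else b y / b x)) =
      fun i => if i = y then (0 : K) else if i = j then (b y)⁻¹ else b i / b y := by
  funext i
  by_cases hiy : i = y
  · rw [if_pos hiy, if_pos hiy]
  · rw [if_neg hiy, if_neg hiy, if_neg hyx, if_neg hyj]
    by_cases hix : i = x
    · rw [if_pos hix, hix, if_neg hxj]
      rw [inv_div]
    · rw [if_neg hix, if_neg hix]
      by_cases hij : i = j
      · rw [if_pos hij, if_pos hij]
        field_simp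
      · rw [if_neg hij, if_neg hij]
        field_simp

end Rechart

/-! ## §2 The weights and the boundary of the two children -/

section Weights

variable [DecidableEq K]

/-- **Weights from the zero pattern**: presentations `(j, b)` and `(x, b′)` of the same point (`x ≠ j`, `b x ≠ 0`, `b′ j ≠ 0`,
the same zero pattern off `{j, x}`) give children whose weight vectors differ by the transposition `swap j x`: the chart
letter is newborn with `ord F − q`, the other one is translated (weight `0`), a third letter keeps `r i` iff untranslated.
[cite: HauserPerlega2019PRIMS, §2 (transform D′ of D)] -/
theorem step_r_of_zeroPattern (q : ℕ) {j x : Fin 4} (hxj : x ≠ j) {b b' : Fin 4 → K} (hbx : b x ≠ 0)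
    (hb'j : b' j ≠ 0) (hzero : ∀ i, i ≠ j → i ≠ x → (b' i = 0 ↔ b i = 0)) (s : State K) :
    (CentreBlowup.step q Finset.univ x b' s).r = (CentreBlowup.step q Finset.univ j b s).r.mapDomain (Equiv.swap j x) := by
  ext i
  rw [Finsupp.mapDomain_equiv_apply, Equiv.symm_swap]
  by_cases hix : i = x
  · rw [hix, Equiv.swap_apply_right, NearDim.step_r_self, NearDim.step_r_self]
  · by_cases hij : i = j
    · rw [hij, Equiv.swap_apply_left, KangarooLoss.step_r_apply_of_ne' q _ hxj.symm, if_neg hb'j,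
        KangarooLoss.step_r_apply_of_ne' q _ hxj, if_neg hbx]
    · rw [Equiv.swap_apply_of_ne_of_ne hij hix, KangarooLoss.step_r_apply_of_ne' q _ hix,
        KangarooLoss.step_r_apply_of_ne' q _ hij]
      simp only [hzero i hij hix]

/-- Total boundary weight from the zero pattern: `|r″| = |r′|`. [folklore] -/
theorem degree_step_r_of_zeroPattern (q : ℕ) {j x : Fin 4} (hxj : x ≠ j) {b b' : Fin 4 → K} (hbx : b x ≠ 0)
    (hb'j : b' j ≠ 0) (hzero : ∀ i, i ≠ j → i ≠ x → (b' i = 0 ↔ b i = 0)) (s : State K) :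
    (CentreBlowup.step q Finset.univ x b' s).r.degree = (CentreBlowup.step q Finset.univ j b s).r.degree := by
  rw [step_r_of_zeroPattern q hxj hbx hb'j hzero s, Finsupp.degree_eq_sum, Finsupp.degree_eq_sum]
  simp only [Finsupp.mapDomain_equiv_apply, Equiv.symm_swap]
  exact Equiv.sum_comp (Equiv.swap j x) (fun i => (CentreBlowup.step q Finset.univ j b s).r i)

/-- «All weights `≤ m`» from the zero pattern (the light readings transfer). [folklore] -/
theorem step_r_le_iff_of_zeroPattern (q : ℕ) {j x : Fin 4} (hxj : x ≠ j) {b b' : Fin 4 → K} (hbx : b x ≠ 0)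
    (hb'j : b' j ≠ 0) (hzero : ∀ i, i ≠ j → i ≠ x → (b' i = 0 ↔ b i = 0)) (s : State K) (m : ℕ) :
    (∀ i, (CentreBlowup.step q Finset.univ x b' s).r i ≤ m) ↔ ∀ i, (CentreBlowup.step q Finset.univ j b s).r i ≤ m := by
  simp only [step_r_of_zeroPattern q hxj hbx hb'j hzero s, Finsupp.mapDomain_equiv_apply, Equiv.symm_swap]
  exact ⟨fun h i => by simpa only [Equiv.swap_apply_self] using h (Equiv.swap j x i), fun h i => h _⟩

/-- **The boundary set from the zero pattern**: `exc″ = (swap j x) '' exc′` (`b′ x = 0` is not even needed: the chart letter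
is always in `exc`). [cite: Hauser2010, §F (transform D′)] -/
theorem step_exc_of_zeroPattern (q : ℕ) {j x : Fin 4} (hxj : x ≠ j) {b b' : Fin 4 → K} (hbx : b x ≠ 0)
    (hb'j : b' j ≠ 0) (hzero : ∀ i, i ≠ j → i ≠ x → (b' i = 0 ↔ b i = 0)) (s : State K) :
    (CentreBlowup.step q Finset.univ x b' s).exc =
      (CentreBlowup.step q Finset.univ j b s).exc.map (Equiv.swap j x).toEmbedding := by
  ext i
  rw [Finset.mem_map_equiv, Equiv.symm_swap, KangarooLoss.mem_step_exc_iff, KangarooLoss.mem_step_exc_iff]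
  by_cases hix : i = x
  · rw [hix, Equiv.swap_apply_right]
    simp only [true_or]
  · by_cases hij : i = j
    · rw [hij, Equiv.swap_apply_left]
      simp only [hxj.symm, hb'j, and_false, or_self, hxj, hbx]
    · rw [Equiv.swap_apply_of_ne_of_ne hij hix]
      simp only [hix, hij, hzero i hij hix, false_or]

/-- **Same shade as soon as the orders agree** (zero-pattern form): the shade is `ord₀ F − |r|` and `|r″| = |r′|`, so an
order identity between the two children — the `F`-side (res-dim4-p-1 g4's `lossy_partner_package`), NOT proved here —
gives the shade identity. [cite: Hauser2010, §F (definition of the shade)] -/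
theorem shade_step_of_zeroPattern (q : ℕ) {j x : Fin 4} (hxj : x ≠ j) {b b' : Fin 4 → K} (hbx : b x ≠ 0)
    (hb'j : b' j ≠ 0) (hzero : ∀ i, i ≠ j → i ≠ x → (b' i = 0 ↔ b i = 0)) (s : State K)
    (hord : ordZero (CentreBlowup.step q Finset.univ x b' s).F = ordZero (CentreBlowup.step q Finset.univ j b s).F) :
    (CentreBlowup.step q Finset.univ x b' s).shade = (CentreBlowup.step q Finset.univ j b s).shade := by
  unfold CState.shade
  rw [hord, degree_step_r_of_zeroPattern q hxj hbx hb'j hzero s]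

/-- **`step_weights_of_rechart` — THE PRESENTATION PRINCIPLE, weight side**: for a chart `j`, a translation `b` and a letter
`x ≠ j` with `b x ≠ 0`, the child of the re-charted presentation `(x, b′)`, `b′ = (0 at x, (b x)⁻¹ at j, b i / b x else)`,
has weight vector `(step q univ j b s).r ∘ swap j x`. [cite: HauserPerlega2019PRIMS, §2 (transform D′ of D)] -/
theorem step_weights_of_rechart (q : ℕ) {j x : Fin 4} (hxj : x ≠ j) {b : Fin 4 → K} (hbx : b x ≠ 0) (s : State K) :
    (CentreBlowup.step q Finset.univ x
        (fun i => if i = x then (0 : K) else if i = j then (b x)⁻¹ else b i / b x) s).r =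
      (CentreBlowup.step q Finset.univ j b s).r.mapDomain (Equiv.swap j x) :=
  step_r_of_zeroPattern q hxj hbx (rechart_zeroPattern hxj hbx).2.1 (rechart_zeroPattern hxj hbx).2.2 s

/-- Letter by letter: `r″ i = r′ (swap j x i)`. [cite: HauserPerlega2019PRIMS, §2 (transform D′ of D)] -/
theorem step_r_apply_rechart (q : ℕ) {j x : Fin 4} (hxj : x ≠ j) {b : Fin 4 → K} (hbx : b x ≠ 0) (s : State K)
    (i : Fin 4) :
    (CentreBlowup.step q Finset.univ x
        (fun i => if i = x then (0 : K) else if i = j then (b x)⁻¹ else b i / b x) s).r i =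
      (CentreBlowup.step q Finset.univ j b s).r (Equiv.swap j x i) := by
  rw [step_weights_of_rechart q hxj hbx s, Finsupp.mapDomain_equiv_apply, Equiv.symm_swap]

/-- The boundary set of the re-charted child: `exc″ = (swap j x) '' exc′`. [cite: Hauser2010, §F (transform D′)] -/
theorem step_exc_of_rechart (q : ℕ) {j x : Fin 4} (hxj : x ≠ j) {b : Fin 4 → K} (hbx : b x ≠ 0) (s : State K) :
    (CentreBlowup.step q Finset.univ x
        (fun i => if i = x then (0 : K) else if i = j then (b x)⁻¹ else b i / b x) s).exc =
      (CentreBlowup.step q Finset.univ j b s).exc.map (Equiv.swap j x).toEmbedding :=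
  step_exc_of_zeroPattern q hxj hbx (rechart_zeroPattern hxj hbx).2.1 (rechart_zeroPattern hxj hbx).2.2 s

end Weights

/-! ## §3 The loss count of the point -/

section Loss

variable [DecidableEq K] {j x : Fin 4} {b b' : Fin 4 → K}

/-- **The boundary letters non-zero at the point are presentation-independent** (zero-pattern form): for presentations
`(j, b)`, `(x, b′)` of one point (`b x ≠ 0`, `b′ j ≠ 0`, same zero pattern off `{j, x}`) the sets
`{i : (i = j ∨ b i ≠ 0) ∧ r i ≠ 0}` and `{i : (i = x ∨ b′ i ≠ 0) ∧ r i ≠ 0}` coincide. [folklore] -/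
theorem boundaryLetters_of_zeroPattern (hbx : b x ≠ 0) (hb'j : b' j ≠ 0)
    (hzero : ∀ i, i ≠ j → i ≠ x → (b' i = 0 ↔ b i = 0)) (s : State K) :
    (Finset.univ.filter fun i => (i = x ∨ b' i ≠ 0) ∧ s.r i ≠ 0) =
      Finset.univ.filter fun i => (i = j ∨ b i ≠ 0) ∧ s.r i ≠ 0 := by
  ext i
  simp only [Finset.mem_filter, Finset.mem_univ, true_and]
  by_cases hix : i = x
  · rw [hix]; exact ⟨fun h => ⟨Or.inr hbx, h.2⟩, fun h => ⟨Or.inl rfl, h.2⟩⟩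
  · by_cases hij : i = j
    · rw [hij]; exact ⟨fun h => ⟨Or.inl rfl, h.2⟩, fun h => ⟨Or.inr hb'j, h.2⟩⟩
    · rw [Ne, hzero i hij hix]
      simp only [hix, hij, false_or]

/-- The presentation-independence of the loss count (zero-pattern form). [folklore] -/
theorem lossCount_eq_of_zeroPattern (hbx : b x ≠ 0) (hb'j : b' j ≠ 0)
    (hzero : ∀ i, i ≠ j → i ≠ x → (b' i = 0 ↔ b i = 0)) (s : State K) :
    (Finset.univ.filter fun i => (i = x ∨ b' i ≠ 0) ∧ s.r i ≠ 0).card =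
      (Finset.univ.filter fun i => (i = j ∨ b i ≠ 0) ∧ s.r i ≠ 0).card := by
  rw [boundaryLetters_of_zeroPattern hbx hb'j hzero s]

/-- **`lossCount_eq_of_rechart`**: the number of boundary letters non-zero at the point `e_j + b` is the same read in the
re-charted presentation `(x, b′)` (`x ≠ j`, `b x ≠ 0`). [folklore] -/
theorem lossCount_eq_of_rechart (hxj : x ≠ j) (hbx : b x ≠ 0) (s : State K) :
    (Finset.univ.filter fun i =>
        (i = x ∨ (if i = x then (0 : K) else if i = j then (b x)⁻¹ else b i / b x) ≠ 0) ∧ s.r i ≠ 0).card =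
      (Finset.univ.filter fun i => (i = j ∨ b i ≠ 0) ∧ s.r i ≠ 0).card :=
  lossCount_eq_of_zeroPattern hbx (rechart_zeroPattern hxj hbx).2.1 (rechart_zeroPattern hxj hbx).2.2 s

/-- **The letters LOST by the presentation `(j, b)`** (translated boundary letters) are the boundary letters non-zero at the
point minus the chart letter (`b j = 0`). [cite: HauserPerlega2019PRIMS, §2 (transform D′ of D)] -/
theorem lostLetters_eq_erase (hbj : b j = 0) (s : State K) :
    (Finset.univ.filter fun i => b i ≠ 0 ∧ s.r i ≠ 0) =
      (Finset.univ.filter fun i => (i = j ∨ b i ≠ 0) ∧ s.r i ≠ 0).erase j := by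
  ext i
  simp only [Finset.mem_filter, Finset.mem_univ, true_and, Finset.mem_erase]
  constructor
  · rintro ⟨hbi, hri⟩
    exact ⟨fun h => hbi (h ▸ hbj), Or.inr hbi, hri⟩
  · rintro ⟨hij, hj | hbi, hri⟩
    · exact absurd hj hij
    · exact ⟨hbi, hri⟩

/-- The presentation `(j, b)` is LOSS-FREE (`b i ≠ 0 → r i = 0`) iff every boundary letter non-zero at the point is the chart
letter (`b j = 0`). [folklore] -/
theorem lossFree_iff_subset (hbj : b j = 0) (s : State K) :
    (∀ i, b i ≠ 0 → s.r i = 0) ↔ (Finset.univ.filter fun i => (i = j ∨ b i ≠ 0) ∧ s.r i ≠ 0) ⊆ {j} := by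
  simp only [Finset.subset_singleton_iff', Finset.mem_filter, Finset.mem_univ, true_and]
  constructor
  · rintro h i ⟨hj | hbi, hri⟩
    · exact hj
    · exact absurd (h i hbi) hri
  · intro h i hbi
    by_contra hri
    exact hbi (by rw [h i ⟨Or.inr hbi, hri⟩, hbj])

omit [DecidableEq K] in
/-- Loss-freeness from the zero pattern: `(x, b′)` is loss-free iff `r j = 0` and no boundary letter other than `x` is
translated by `b` (`b′ x = 0`, `b′ j ≠ 0`, same zero pattern off `{j, x}`). [folklore] -/
theorem lossFree_iff_of_zeroPattern (hb'x : b' x = 0) (hb'j : b' j ≠ 0)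
    (hzero : ∀ i, i ≠ j → i ≠ x → (b' i = 0 ↔ b i = 0)) (s : State K) :
    (∀ i, b' i ≠ 0 → s.r i = 0) ↔ (s.r j = 0 ∧ ∀ i, i ≠ x → b i ≠ 0 → s.r i = 0) := by
  constructor
  · intro h
    refine ⟨h j hb'j, fun i hix hbi => ?_⟩
    by_cases hij : i = j
    · exact hij ▸ h j hb'j
    · exact h i (fun h0 => hbi ((hzero i hij hix).1 h0))
  · rintro ⟨hrj, h⟩ i hi
    by_cases hix : i = x
    · exact absurd (hix ▸ hb'x) hi
    · by_cases hij : i = j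
      · rw [hij]; exact hrj
      · exact h i hix (fun h0 => hi ((hzero i hij hix).2 h0))

omit [DecidableEq K] in
/-- **Loss-freeness of the re-charted presentation**: `(x, b′)` is loss-free iff the old chart letter `j` is free and no
boundary letter other than `x` is translated by `b` (`x ≠ j`, `b x ≠ 0`). [folklore] -/
theorem lossFree_rechart_iff (hxj : x ≠ j) (hbx : b x ≠ 0) (s : State K) :
    (∀ i, (if i = x then (0 : K) else if i = j then (b x)⁻¹ else b i / b x) ≠ 0 → s.r i = 0) ↔
      (s.r j = 0 ∧ ∀ i, i ≠ x → b i ≠ 0 → s.r i = 0) :=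
  lossFree_iff_of_zeroPattern (b' := fun i => if i = x then (0 : K) else if i = j then (b x)⁻¹ else b i / b x)
    (rechart_zeroPattern hxj hbx).1 (rechart_zeroPattern hxj hbx).2.1 (rechart_zeroPattern hxj hbx).2.2 s

omit [DecidableEq K] in
/-- **`lossFree_rechart_of_single_loss`** — a step that loses ONE boundary letter `x` from a FREE chart letter is loss-free
once re-charted at `x`: if `s.r j = 0` and every `b`-translated letter other than `x` is free, then the presentation
`(x, b′)` of the same point is loss-free. [folklore] -/
theorem lossFree_rechart_of_single_loss (hxj : x ≠ j) (hbx : b x ≠ 0) (s : State K) (hrj : s.r j = 0)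
    (hfree : ∀ i, i ≠ x → b i ≠ 0 → s.r i = 0) :
    ∀ i, (if i = x then (0 : K) else if i = j then (b x)⁻¹ else b i / b x) ≠ 0 → s.r i = 0 :=
  (lossFree_rechart_iff hxj hbx s).2 ⟨hrj, hfree⟩

/-- **Some presentation of the point is loss-free iff at most one boundary letter is non-zero at it** (`b j = 0`): either
`(j, b)` itself is loss-free, or the re-charted presentation at some `b`-translated letter `x` is. [folklore] -/
theorem lossCount_le_one_iff_exists_lossFree (hbj : b j = 0) (s : State K) :
    (Finset.univ.filter fun i => (i = j ∨ b i ≠ 0) ∧ s.r i ≠ 0).card ≤ 1 ↔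
      ((∀ i, b i ≠ 0 → s.r i = 0) ∨ ∃ x, x ≠ j ∧ b x ≠ 0 ∧
        ∀ i, (if i = x then (0 : K) else if i = j then (b x)⁻¹ else b i / b x) ≠ 0 → s.r i = 0) := by
  have hmem : ∀ i, i ∈ (Finset.univ.filter fun i => (i = j ∨ b i ≠ 0) ∧ s.r i ≠ 0) ↔
      (i = j ∨ b i ≠ 0) ∧ s.r i ≠ 0 := fun i => by
    rw [Finset.mem_filter]; exact and_iff_right (Finset.mem_univ i)
  rw [Finset.card_le_one]
  constructor
  · intro h
    by_cases hfree : ∀ i, b i ≠ 0 → s.r i = 0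
    · exact Or.inl hfree
    · push Not at hfree
      obtain ⟨x, hbx, hrx⟩ := hfree
      have hxj : x ≠ j := fun h0 => hbx (h0 ▸ hbj)
      have hxB := (hmem x).2 ⟨Or.inr hbx, hrx⟩
      refine Or.inr ⟨x, hxj, hbx, (lossFree_rechart_iff hxj hbx s).2 ⟨?_, fun i hix hbi => ?_⟩⟩
      · by_contra hrj
        exact hxj (h x hxB j ((hmem j).2 ⟨Or.inl rfl, hrj⟩))
      · by_contra hri
        exact hix (h i ((hmem i).2 ⟨Or.inr hbi, hri⟩) x hxB)
  · rintro (hfree | ⟨x, hxj, hbx, hfree⟩) a ha c hc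
    · have ha' := (lossFree_iff_subset hbj s).1 hfree ha
      have hc' := (lossFree_iff_subset hbj s).1 hfree hc
      rw [Finset.mem_singleton] at ha' hc'
      rw [ha', hc']
    · obtain ⟨hrj, hf⟩ := (lossFree_rechart_iff hxj hbx s).1 hfree
      have key : ∀ i, i ∈ (Finset.univ.filter fun i => (i = j ∨ b i ≠ 0) ∧ s.r i ≠ 0) → i = x := fun i hi => by
        obtain ⟨hi1, hri⟩ := (hmem i).1 hi
        by_contra hix
        rcases hi1 with hij | hbi
        · exact hri (hij ▸ hrj)
        · exact hri (hf i hix hbi)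
      rw [key a ha, key c hc]

/-- **`two_le_lossCount_iff_forall_lossy` — GENUINELY LOSSY ⟺ AT LEAST TWO BOUNDARY LETTERS ARE NON-ZERO AT THE POINT**
(`b j = 0`): the presentation `(j, b)` is lossy AND every re-charted presentation `(x, b′)` (`x ≠ j`, `b x ≠ 0`) is lossy,
iff `2 ≤ |{i : (i = j ∨ b i ≠ 0) ∧ r i ≠ 0}|`. [folklore] -/
theorem two_le_lossCount_iff_forall_lossy (hbj : b j = 0) (s : State K) :
    2 ≤ (Finset.univ.filter fun i => (i = j ∨ b i ≠ 0) ∧ s.r i ≠ 0).card ↔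
      (¬ (∀ i, b i ≠ 0 → s.r i = 0) ∧ ∀ x, x ≠ j → b x ≠ 0 →
        ¬ ∀ i, (if i = x then (0 : K) else if i = j then (b x)⁻¹ else b i / b x) ≠ 0 → s.r i = 0) := by
  have h := lossCount_le_one_iff_exists_lossFree hbj s
  constructor
  · intro h2
    have hn : ¬ ((∀ i, b i ≠ 0 → s.r i = 0) ∨ ∃ x, x ≠ j ∧ b x ≠ 0 ∧
        ∀ i, (if i = x then (0 : K) else if i = j then (b x)⁻¹ else b i / b x) ≠ 0 → s.r i = 0) := fun hor => by
      have := h.2 hor; omega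
    exact ⟨fun hf => hn (Or.inl hf), fun x hxj hbx hf => hn (Or.inr ⟨x, hxj, hbx, hf⟩)⟩
  · rintro ⟨h1, h2⟩
    by_contra hlt
    rcases h.1 (by omega) with hf | ⟨x, hxj, hbx, hf⟩
    · exact h1 hf
    · exact h2 x hxj hbx hf

end Loss

end ResCone

end Summit.ResolutionOfSingularities.ResolutionOfSingularities.Theorems.PIDim4

end
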